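import Literature.NumberTheory.LFunctions.SuzukiSingleOperatorKernelProofs
import Literature.NumberTheory.LFunctions.PowerOscillatoryIntegrals
import Summits.RiemannHypothesis.RiemannHypothesis.Theorems.SuzukiWindowsDoorLaplacePower

/-!
# SuzukiWindowsDoorLaplacePowerReal — inverse Laplace transform of a REAL power on a vertical line: `(2π)⁻¹∫_{Im z=b} (½ − iz)^{−θ} e^{−izx} dz = x₊^{θ−1} e^{−x/2}/Γ(θ)`, `θ > 1` (column DBR; RH-FREE)

RH-FREE throughout (no `ζ` at all); nothing here bears on the truth of RH.  The real-exponent companion of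
`SuzukiWindowsDoorLaplacePower` (eng-3 g5, integer exponents `k + 1`): for every REAL `θ > 1`, every line `b > −½`
and all real `x`,

  `invFourierLine (fun z => ((½ − iz)^θ)⁻¹) b x = (max x 0)^{θ−1} · e^{−x/2} / Γ(θ)`   (principal `cpow`),

and the general abscissa `invFourierLine (fun z => ((c − iz)^θ)⁻¹) b x = (max x 0)^{θ−1} e^{−cx}/Γ(θ)` (`c + b > 0`) —
the first brick of the small-`x` / small-window laws for NON-INTEGER `θ` (DATA-1b's `θ ∈ {5/4, 3/2}`, EXP-R2a's pair
`3/2 → 2`, theory's `θ → 1⁺` regime).  The complex-rate Gamma integral `∫₀^∞ t^{θ−1}e^{−rt}dt = Γ(θ) r^{−θ}` (`Re r > 0`)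
is the tree's `Literature.NumberTheory.LFunctions.AFE.integral_cpow_mul_exp_neg_mul_Ioi_complex` (analytic continuation of
Mathlib's real-rate lemma); the rest follows g5's file: Fourier transform of the model, integrability of both sides
(`‖(σ+2πiξ)^{−θ}‖ = ‖σ+2πiξ‖^{−θ} ≤ (m/2)^{−θ/2}(1+|ξ|)^{−θ}`, `m = min(σ², 4π²)`), Mathlib's Fourier inversion, `u = −2πξ`.

References: [Su20] M. Suzuki, ASPM 84 (2020) = arXiv:1907.07302, §3; DLMF 5.9.1.
-/

noncomputable section

-- D-0017: `Summit.<S>.<S>.…` is the designed namespace of a single-problem summit.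
set_option linter.dupNamespace false

open MeasureTheory Set Filter Topology Complex

namespace Summit.RiemannHypothesis.RiemannHypothesis.Theorems.SuzukiWindowsDoorLaplacePowerReal

open Literature.NumberTheory.LFunctions
open Summit.RiemannHypothesis.RiemannHypothesis.Theorems.SuzukiWindowsDoorLaplacePower (normSq_rate)
open scoped Real FourierTransform

/-! ## §1 The model function `f(x) = (max x 0)^{θ−1} e^{−σx}/Γ(θ)` -/

variable {θ : ℝ}

/-- Continuity of `x ↦ (max x 0)^{θ−1} e^{−σx}/Γ(θ)` (`θ > 1`). -/
theorem continuous_model (hθ : 1 < θ) (σ : ℝ) :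
    Continuous fun x : ℝ => (((max x 0) ^ (θ - 1) * Real.exp (-(σ * x)) / Real.Gamma θ : ℝ) : ℂ) := by
  have h1 : Continuous fun x : ℝ => (max x 0) ^ (θ - 1) :=
    (continuous_id.max continuous_const).rpow_const fun _ => Or.inr (by linarith)
  exact Complex.continuous_ofReal.comp ((h1.mul (by fun_prop)).div_const _)

/-- On `(−∞, 0]` the model function vanishes (`θ > 1`). -/
theorem model_eq_zero_of_nonpos (hθ : 1 < θ) (σ : ℝ) {x : ℝ} (hx : x ≤ 0) :
    (((max x 0) ^ (θ - 1) * Real.exp (-(σ * x)) / Real.Gamma θ : ℝ) : ℂ) = 0 := by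
  rw [max_eq_right hx, Real.zero_rpow (by linarith)]
  simp

/-- On `(0, ∞)` the model function is `x^{θ−1} e^{−σx}/Γ(θ)` (complex power of a positive real). -/
theorem model_eq_of_pos (θ σ : ℝ) {x : ℝ} (hx : 0 < x) :
    (((max x 0) ^ (θ - 1) * Real.exp (-(σ * x)) / Real.Gamma θ : ℝ) : ℂ) =
      (x : ℂ) ^ ((θ : ℂ) - 1) * Complex.exp (-((σ : ℂ) * x)) / (Real.Gamma θ : ℂ) := by
  rw [max_eq_left hx.le]
  push_cast
  rw [Complex.ofReal_cpow hx.le]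
  push_cast
  ring_nf

/-- Integrability of the model function on `ℝ` (`θ > 1`, `σ > 0`). -/
theorem integrable_model (hθ : 1 < θ) {σ : ℝ} (hσ : 0 < σ) :
    Integrable fun x : ℝ => (((max x 0) ^ (θ - 1) * Real.exp (-(σ * x)) / Real.Gamma θ : ℝ) : ℂ) := by
  have hIoi : IntegrableOn (fun x : ℝ => (((max x 0) ^ (θ - 1) * Real.exp (-(σ * x)) / Real.Gamma θ : ℝ) : ℂ))
      (Ioi 0) := by
    have h := integrableOn_rpow_mul_exp_neg_mul_rpow (s := θ - 1) (p := 1) (by linarith) le_rfl hσ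
    have h' : IntegrableOn (fun x : ℝ => (((x ^ (θ - 1) * Real.exp (-σ * x ^ (1 : ℝ))) / Real.Gamma θ : ℝ) : ℂ))
        (Ioi 0) := (h.div_const _).ofReal
    refine h'.congr_fun (fun x hx => ?_) measurableSet_Ioi
    have hx' : 0 < x := hx
    dsimp only
    rw [max_eq_left hx'.le, Real.rpow_one, neg_mul]
  have hIic : IntegrableOn (fun x : ℝ => (((max x 0) ^ (θ - 1) * Real.exp (-(σ * x)) / Real.Gamma θ : ℝ) : ℂ))
      (Iic 0) :=
    integrableOn_zero.congr_fun (fun x hx => (model_eq_zero_of_nonpos hθ σ hx).symm) measurableSet_Iic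
  have h := hIic.union hIoi
  rwa [Iic_union_Ioi, integrableOn_univ] at h

/-! ## §2 The Fourier transform of the model function -/

/-- `Re(σ + 2πiξ) = σ` and the rate is not on the branch cut. -/
theorem rate_re (σ ξ : ℝ) : ((σ : ℂ) + 2 * π * ξ * I).re = σ := by simp

/-- The rate `σ + 2πiξ` (`σ > 0`) is off the branch cut of the principal power. -/
theorem rate_arg_ne_pi {σ : ℝ} (hσ : 0 < σ) (ξ : ℝ) : ((σ : ℂ) + 2 * π * ξ * I).arg ≠ π := by
  intro h
  have h1 := (Complex.arg_eq_pi_iff.1 h).1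
  rw [rate_re] at h1
  linarith

/-- **`𝓕f(ξ) = ((σ + 2πiξ)^θ)⁻¹`** (`σ > 0`, `θ > 1`): the complex-rate Gamma integral (tree:
`AFE.integral_cpow_mul_exp_neg_mul_Ioi_complex`). -/
theorem fourier_model (hθ : 1 < θ) {σ : ℝ} (hσ : 0 < σ) (ξ : ℝ) :
    𝓕 (fun x : ℝ => (((max x 0) ^ (θ - 1) * Real.exp (-(σ * x)) / Real.Gamma θ : ℝ) : ℂ)) ξ =
      (((σ : ℂ) + 2 * π * ξ * I) ^ (θ : ℂ))⁻¹ := by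
  have hre : 0 < ((σ : ℂ) + 2 * π * ξ * I).re := by rw [rate_re]; exact hσ
  have hθre : 0 < (θ : ℂ).re := by simp; linarith
  have hG0 : (Real.Gamma θ : ℂ) ≠ 0 := by exact_mod_cast (Real.Gamma_pos_of_pos (by linarith)).ne'
  rw [Real.fourier_real_eq_integral_exp_smul,
    ← setIntegral_eq_integral_of_forall_compl_eq_zero (s := Ioi (0 : ℝ)) (fun x hx => by
      rw [model_eq_zero_of_nonpos hθ σ (not_lt.1 hx), smul_zero])]
  have hpt : ∀ x ∈ Ioi (0 : ℝ), Complex.exp (↑(-2 * π * x * ξ) * I) •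
      (((max x 0) ^ (θ - 1) * Real.exp (-(σ * x)) / Real.Gamma θ : ℝ) : ℂ) =
      (1 / (Real.Gamma θ : ℂ)) * ((x : ℂ) ^ ((θ : ℂ) - 1) * Complex.exp (-(((σ : ℂ) + 2 * π * ξ * I) * x))) := by
    intro x hx
    rw [model_eq_of_pos θ σ hx, smul_eq_mul]
    rw [show -(((σ : ℂ) + 2 * π * ξ * I) * x) = -((σ : ℂ) * x) + (↑(-2 * π * x * ξ) * I) by push_cast; ring,
      Complex.exp_add]
    field_simp
  rw [setIntegral_congr_fun measurableSet_Ioi hpt, integral_const_mul,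
    AFE.integral_cpow_mul_exp_neg_mul_Ioi_complex hθre hre, Complex.Gamma_ofReal,
    show (1 / ((σ : ℂ) + 2 * π * ξ * I)) = ((σ : ℂ) + 2 * π * ξ * I)⁻¹ from one_div _,
    Complex.inv_cpow _ _ (rate_arg_ne_pi hσ ξ)]
  field_simp

/-- `√(m/2)·(1 + |ξ|) ≤ ‖σ + 2πiξ‖`, `m = min(σ², 4π²)`. -/
theorem sqrt_mul_one_add_abs_le_norm_rate {σ : ℝ} (hσ : 0 < σ) (ξ : ℝ) :
    Real.sqrt (min (σ ^ 2) (4 * π ^ 2) / 2) * (1 + |ξ|) ≤ ‖(σ : ℂ) + 2 * π * ξ * I‖ := by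
  set m : ℝ := min (σ ^ 2) (4 * π ^ 2) with hm
  have hmpos : 0 < m := lt_min (by positivity) (by positivity)
  have h1 : m ≤ σ ^ 2 := min_le_left _ _
  have h2 : m ≤ 4 * π ^ 2 := min_le_right _ _
  have hsq : (Real.sqrt (m / 2) * (1 + |ξ|)) ^ 2 ≤ ‖(σ : ℂ) + 2 * π * ξ * I‖ ^ 2 := by
    rw [mul_pow, Real.sq_sqrt (by positivity), normSq_rate]
    have habs : |ξ| ^ 2 = ξ ^ 2 := sq_abs ξ
    nlinarith [abs_nonneg ξ, sq_nonneg (1 - |ξ|)]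
  exact (pow_le_pow_iff_left₀ (by positivity) (norm_nonneg _) two_ne_zero).mp hsq

/-- **Integrability of `𝓕f`** for `θ > 1`, `σ > 0`: `‖((σ+2πiξ)^θ)⁻¹‖ = ‖σ+2πiξ‖^{−θ} ≤ (m/2)^{−θ/2}(1+|ξ|)^{−θ}`. -/
theorem integrable_fourier_model (hθ : 1 < θ) {σ : ℝ} (hσ : 0 < σ) :
    Integrable fun ξ : ℝ => ((((σ : ℂ) + 2 * π * ξ * I) ^ (θ : ℂ))⁻¹) := by
  set c : ℝ := Real.sqrt (min (σ ^ 2) (4 * π ^ 2) / 2) with hc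
  have hcpos : 0 < c := Real.sqrt_pos.mpr (by
    have : 0 < min (σ ^ 2) (4 * π ^ 2) := lt_min (by positivity) (by positivity)
    positivity)
  have hθ0 : 0 < θ := by linarith
  have hne : ∀ ξ : ℝ, ((σ : ℂ) + 2 * π * ξ * I) ≠ 0 := fun ξ h => by
    have := congrArg Complex.re h
    simp at this
    linarith
  have hmaj : Integrable (fun ξ : ℝ => (c ^ θ)⁻¹ * (1 + ‖ξ‖) ^ (-θ)) :=
    (integrable_one_add_norm (E := ℝ) (μ := volume) (by simp; exact hθ)).const_mul _
  refine hmaj.mono' ?_ (Eventually.of_forall fun ξ => ?_)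
  · refine (Continuous.inv₀ ?_ fun ξ => ?_).aestronglyMeasurable
    · exact Continuous.cpow (by fun_prop) continuous_const fun ξ => by
        left; rw [rate_re]; exact hσ
    · exact (Complex.cpow_ne_zero_iff_of_exponent_ne_zero (by
        intro h; have := congrArg Complex.re h; simp at this; linarith)).mpr (hne ξ)
  · have hN := sqrt_mul_one_add_abs_le_norm_rate hσ ξ
    rw [← hc] at hN
    rw [norm_inv, Complex.norm_cpow_real, Real.norm_eq_abs]
    have hpos : 0 < c * (1 + |ξ|) := by positivity
    have h1 : (c * (1 + |ξ|)) ^ θ ≤ ‖(σ : ℂ) + 2 * π * ξ * I‖ ^ θ :=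
      Real.rpow_le_rpow hpos.le hN hθ0.le
    calc (‖(σ : ℂ) + 2 * π * ξ * I‖ ^ θ)⁻¹ ≤ ((c * (1 + |ξ|)) ^ θ)⁻¹ :=
          inv_anti₀ (Real.rpow_pos_of_pos hpos θ) h1
      _ = (c ^ θ)⁻¹ * (1 + |ξ|) ^ (-θ) := by
          rw [Real.mul_rpow hcpos.le (by positivity), mul_inv, Real.rpow_neg (by positivity)]

/-! ## §3 Fourier inversion and the line transform of `(c − iz)^{−θ}` -/

/-- **Inverse Laplace transform of a shifted REAL power on the line `Im z = b`** (RH-free): for real `θ > 1`, real `c`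
and any line `b` with `c + b > 0`,
`invFourierLine (fun z => ((c − iz)^θ)⁻¹) b x = (max x 0)^{θ−1} e^{−cx}/Γ(θ)` — independent of the line
(Fourier inversion for the model with `σ = c + b`, substitution `u = −2πξ`). -/
theorem invFourierLine_inv_cpow_shift (hθ : 1 < θ) {c b : ℝ} (hcb : 0 < c + b) (x : ℝ) :
    invFourierLine (fun z : ℂ => (((c : ℂ) - I * z) ^ (θ : ℂ))⁻¹) b x =
      (((max x 0) ^ (θ - 1) * Real.exp (-(c * x)) / Real.Gamma θ : ℝ) : ℂ) := by
  set σ : ℝ := c + b with hσdef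
  have hσ : 0 < σ := hcb
  set f : ℝ → ℂ := fun y => (((max y 0) ^ (θ - 1) * Real.exp (-(σ * y)) / Real.Gamma θ : ℝ) : ℂ) with hfdef
  have hFf : 𝓕 f = fun ξ : ℝ => ((((σ : ℂ) + 2 * π * ξ * I) ^ (θ : ℂ))⁻¹) := funext (fourier_model hθ hσ)
  have hinv : 𝓕⁻ (𝓕 f) = f :=
    (continuous_model hθ σ).fourierInv_fourier_eq (integrable_model hθ hσ)
      (by rw [hFf]; exact integrable_fourier_model hθ hσ)
  have hfx : f x = ∫ v : ℝ, Complex.exp (↑(-2 * π * v * -x) * I) •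
      ((((σ : ℂ) + 2 * π * v * I) ^ (θ : ℂ))⁻¹) := by
    have h := congr_fun hinv x
    rw [Real.fourierInv_eq_fourier_neg, Real.fourier_real_eq_integral_exp_smul, hFf] at h
    exact h.symm
  have hsub := Measure.integral_comp_mul_left
    (fun u : ℝ => ((((c : ℂ) - I * ((u : ℂ) + (b : ℂ) * I)) ^ (θ : ℂ))⁻¹ *
      Complex.exp (-I * ((u : ℂ) + (b : ℂ) * I) * (x : ℂ)))) (-(2 * π))
  have habs : |(-(2 * π))⁻¹| = 1 / (2 * π) := by
    rw [abs_inv, abs_neg, abs_of_pos (by positivity)]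
    ring
  rw [habs] at hsub
  have hJ : (1 : ℂ) / (2 * (π : ℂ)) * ∫ u : ℝ, (((c : ℂ) - I * ((u : ℂ) + (b : ℂ) * I)) ^ (θ : ℂ))⁻¹ *
        Complex.exp (-I * ((u : ℂ) + (b : ℂ) * I) * (x : ℂ)) =
      ∫ v : ℝ, (((c : ℂ) - I * ((((-(2 * π)) * v : ℝ) : ℂ) + (b : ℂ) * I)) ^ (θ : ℂ))⁻¹ *
        Complex.exp (-I * ((((-(2 * π)) * v : ℝ) : ℂ) + (b : ℂ) * I) * (x : ℂ)) := by
    rw [hsub, Complex.real_smul]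
    congr 1
    push_cast
    ring
  have hpt : ∀ v : ℝ, (((c : ℂ) - I * ((((-(2 * π)) * v : ℝ) : ℂ) + (b : ℂ) * I)) ^ (θ : ℂ))⁻¹ *
        Complex.exp (-I * ((((-(2 * π)) * v : ℝ) : ℂ) + (b : ℂ) * I) * (x : ℂ)) =
      Complex.exp ((b * x : ℝ) : ℂ) *
        (Complex.exp (↑(-2 * π * v * -x) * I) • ((((σ : ℂ) + 2 * π * v * I) ^ (θ : ℂ))⁻¹)) := by
    intro v
    have h1 : (c : ℂ) - I * ((((-(2 * π)) * v : ℝ) : ℂ) + (b : ℂ) * I) = (σ : ℂ) + 2 * π * v * I := by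
      rw [hσdef]
      push_cast
      linear_combination (-(b : ℂ)) * I_mul_I
    have h2 : -I * ((((-(2 * π)) * v : ℝ) : ℂ) + (b : ℂ) * I) * (x : ℂ) =
        ((b * x : ℝ) : ℂ) + (↑(-2 * π * v * -x) * I) := by
      push_cast
      linear_combination (-(b : ℂ) * x) * I_mul_I
    rw [h1, h2, Complex.exp_add, smul_eq_mul]
    ring
  simp only [invFourierLine]
  rw [hJ]
  simp_rw [hpt]
  rw [integral_const_mul, ← hfx, hfdef]
  have hexp : Real.exp (b * x) * Real.exp (-(σ * x)) = Real.exp (-(c * x)) := by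
    rw [← Real.exp_add, hσdef]
    congr 1
    ring
  rw [← Complex.ofReal_exp, ← Complex.ofReal_mul]
  congr 1
  rw [← hexp]
  ring

/-- **Inverse Laplace transform of `(½ − iz)^{−θ}`** (RH-free): for real `θ > 1`, `b > −½` and all real `x`,
`invFourierLine (fun z => ((½ − iz)^θ)⁻¹) b x = (max x 0)^{θ−1} e^{−x/2}/Γ(θ)` — the exact line transform of the Stirling
leading term `(2π)^θ s^{−θ}` of `Θ_θ^arch` for every real `θ > 1`. -/
theorem invFourierLine_inv_cpow (hθ : 1 < θ) {b : ℝ} (hb : -1 / 2 < b) (x : ℝ) :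
    invFourierLine (fun z : ℂ => (((1 : ℂ) / 2 - I * z) ^ (θ : ℂ))⁻¹) b x =
      (((max x 0) ^ (θ - 1) * Real.exp (-(x / 2)) / Real.Gamma θ : ℝ) : ℂ) := by
  have h := invFourierLine_inv_cpow_shift hθ (c := 1 / 2) (b := b) (by linarith) x
  rw [show (((1 / 2 : ℝ) : ℂ)) = (1 : ℂ) / 2 by push_cast; ring] at h
  rw [h]
  congr 3
  ring

/-- The case `x ≤ 0`: the line transform vanishes. -/
theorem invFourierLine_inv_cpow_of_nonpos (hθ : 1 < θ) {b : ℝ} (hb : -1 / 2 < b) {x : ℝ} (hx : x ≤ 0) :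
    invFourierLine (fun z : ℂ => (((1 : ℂ) / 2 - I * z) ^ (θ : ℂ))⁻¹) b x = 0 := by
  rw [invFourierLine_inv_cpow hθ hb, max_eq_right hx, Real.zero_rpow (by linarith)]
  simp

/-- The case `x > 0`: the Gamma density `x^{θ−1} e^{−x/2}/Γ(θ)`. -/
theorem invFourierLine_inv_cpow_of_pos (hθ : 1 < θ) {b : ℝ} (hb : -1 / 2 < b) {x : ℝ} (hx : 0 < x) :
    invFourierLine (fun z : ℂ => (((1 : ℂ) / 2 - I * z) ^ (θ : ℂ))⁻¹) b x =
      ((x ^ (θ - 1) * Real.exp (-(x / 2)) / Real.Gamma θ : ℝ) : ℂ) := by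
  rw [invFourierLine_inv_cpow hθ hb, max_eq_left hx.le]

end Summit.RiemannHypothesis.RiemannHypothesis.Theorems.SuzukiWindowsDoorLaplacePowerReal

end
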